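import Literature.Topology.FourManifolds.HandleSlabBaseMap
import HarnessLib

/-!
# Kosinski's handle presentation theorem (VII 2.2), Part 5d: the embedding
# `M ∖ ⋃ᵢ hᵢ(S) ↪ {F ≤ c - ε}`

Topic `Literature/Topology/FourManifolds`; continuation of `HandleSlabLevel.lean` (Parts 2–4),
`HandleSlabSet.lean` and `HandleSlabBaseMap.lean` (Part 5a, 5c) of the formalisation of Kosinski,
*Differential Manifolds* (1993), VII Prop. 2.2, in the tree's model
`HandleAttachingMap.IsMultiAttachment` of handle attachment (VI §6).

For `D : SlabData n W ι` and the attaching maps `h̄ᵢ = D.attachingMap hn i : T → M` of Part 4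
(`M = {f ≤ c - ε}`), this file packages Kosinski's `σ` (`SlabData.baseAmb`) as **the smooth open
embedding `SlabData.glued : M ∖ ⋃ᵢ h̄ᵢ(S) → P = {F ≤ c - ε}`** of manifolds with boundary
(`HandleAttachingMap.coresComplement (D.attachingMap hn)` into `D.slabSet`): smooth
(`contMDiff_glued`), injective with the explicit inverse `σ⁻¹` (`SlabData.unglue`, smooth on the
range), open (`isOpenMap_glued`), a smooth embedding (`isSmoothEmbedding_glued`), with **range the
slab off the belt discs** `{x ∈ P | |φᵢ(x)_λ|² ≠ 0 whenever x ∈ source φᵢ}`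
(`SlabData.range_glued`; the belt discs `x_λ = 0` of the handles are exactly what `σ` misses,
Kosinski VI §6), and level to level (`isBoundaryPoint_glued_iff`).  Everything here is proved; no
named facts are introduced.

## References

* A. A. Kosinski, *Differential Manifolds*, Academic Press (1993), VII §2, proof of Prop. 2.2,
  (2.2.6)–(2.2.7) (PDF p. 101); VI §6. [Kosinski1993]
-/

open scoped Manifold ContDiff Topology
open Set Function Metric Real Filter

noncomputable section

universe u

namespace Literature.Topology.FourManifolds

open HandleShrink HandleSlab

namespace SlabData

variable {n : ℕ} {W : Type u} [TopologicalSpace W] [ChartedSpace (EuclideanHalfSpace (n + 1)) W]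
  {ι : Type*} [Fintype ι] (D : SlabData n W ι)

/-! ### §1 `σ` misses the belt discs -/

omit [Fintype ι] in
/-- **`σ` takes values off the belt discs**: `|φᵢ(σ q)_λ|² ≠ 0` for `q` in the body off the
attaching spheres. [cite: Kosinski1993, VII (2.2.7)] -/
theorem lamSq_φ_baseAmb_ne_zero {q : W} (hq : D.f q ≤ D.c - D.ε)
    (hc : ∀ i, q ∈ (D.φ i).source → lamSq D.lam (D.φ i q) ≠ D.ε) (i : ι)
    (hs : D.baseAmb q ∈ (D.φ i).source) : lamSq D.lam (D.φ i (D.baseAmb q)) ≠ 0 := by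
  by_cases h : q ∈ ⋃ j, D.K j
  · obtain ⟨j, hj⟩ := mem_iUnion.1 h
    have hsj := D.K_subset_source j hj
    have hL := D.lt_lamSq_of_ne hsj hq (hc j hsj)
    by_cases hL' : lamSq D.lam (D.φ j q) < outer * D.ε
    · obtain ⟨hs', hφ, -⟩ := D.baseAmb_chart hsj hq hL hL'
      have hji : j = i := D.eq_of_mem_source_of_mem_source hs' hs
      subst hji
      rw [hφ]; exact (lamSq_baseMap_mem D.ε_pos hL hL').1.ne'
    · have hge : outer * D.ε ≤ lamSq D.lam (D.φ j q) := not_lt.1 hL'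
      rw [D.baseAmb_eq_self_of_le hsj (D.threshold_le_outer.trans hge)] at hs ⊢
      have hji : j = i := D.eq_of_mem_source_of_mem_source hsj hs
      subst hji
      exact (D.ε_pos.trans hL).ne'
  · rw [D.baseAmb_of_not_mem h] at hs ⊢
    have hm := D.muSq_le_of_mem_bodySet hs hq
    have : D.ε ≤ lamSq D.lam (D.φ i q) := by linarith [muSq_nonneg D.lam (D.φ i q)]
    exact (D.ε_pos.trans_le this).ne'

/-! ### §2 The embedding `σ : M ∖ ⋃ᵢ h̄ᵢ(S) → P` -/

variable [IsManifold (𝓡∂ (n + 1)) ∞ W] [T2Space W] (hn : 1 ≤ n)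

/-- **A point of `M ∖ ⋃ᵢ h̄ᵢ(S)`, read in `W`, is a body point off the attaching spheres**
(`|φᵢ_λ|² ≠ ε`, `SlabData.mem_core_attachingMap_iff`). [cite: Kosinski1993, VII (2.2.5)] -/
theorem offCore (a : ↥(HandleAttachingMap.coresComplement (D.attachingMap hn))) :
    D.f a.1.1 ≤ D.c - D.ε ∧ ∀ i, a.1.1 ∈ (D.φ i).source → lamSq D.lam (D.φ i a.1.1) ≠ D.ε := by
  refine ⟨a.1.2, fun i hs hL => ?_⟩
  have ha := (HandleAttachingMap.mem_coresComplement _).1 a.2 i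
  exact ha ((D.mem_core_attachingMap_iff hn i a.1).2 ⟨hs, hL⟩)

/-- **Kosinski's `σ : M ∖ ⋃ᵢ h̄ᵢ(S) → P = {F ≤ c - ε}`.** [cite: Kosinski1993, VII (2.2.7)] -/
def glued (a : ↥(HandleAttachingMap.coresComplement (D.attachingMap hn))) : ↥D.slabSet :=
  ⟨D.baseAmb a.1.1, (D.F_baseAmb_le (D.offCore hn a).1 (D.offCore hn a).2).1⟩

/-- The point of `W` under `σ`. [folklore] -/
@[simp] theorem coe_glued (a : ↥(HandleAttachingMap.coresComplement (D.attachingMap hn))) :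
    (D.glued hn a).1 = D.baseAmb a.1.1 := rfl

/-- **`σ` is smooth.** [cite: Kosinski1993, VII (2.2.7)] -/
theorem contMDiff_glued : ContMDiff (𝓡∂ (n + 1)) (𝓡∂ (n + 1)) ∞ (D.glued hn) := fun a => by
  apply D.contMDiffAt_slabSet_mk
  have h1 : ContMDiffAt (𝓡∂ (n + 1)) (𝓡∂ (n + 1)) ∞
      (fun z : ↥(HandleAttachingMap.coresComplement (D.attachingMap hn)) => z.1.1) a :=
    ((D.contMDiff_bodySet_val hn).comp contMDiff_subtype_val) a
  have h2 := (D.contMDiffAt_baseAmb (D.offCore hn a).1 (D.offCore hn a).2).comp a h1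
  exact h2

/-- **`σ` is level to level**: `σ a ∈ ∂P` iff `a ∈ ∂M`, i.e. `f a = c - ε`. [cite: Kosinski1993, VII (2.2.7)] -/
theorem isBoundaryPoint_glued_iff (a : ↥(HandleAttachingMap.coresComplement (D.attachingMap hn))) :
    (𝓡∂ (n + 1)).IsBoundaryPoint (D.glued hn a) ↔ D.f a.1.1 = D.c - D.ε := by
  rw [D.isBoundaryPoint_slabSet_iff, coe_glued, (D.F_baseAmb_le (D.offCore hn a).1 (D.offCore hn a).2).2]

/-! #### The range and the inverse -/

/-- **The range of `σ`: the slab off the belt discs** `{|φᵢ_λ|² = 0}`. [cite: Kosinski1993, VI §6] -/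
def gluedRange : Set ↥D.slabSet := {x | ∀ i, x.1 ∈ (D.φ i).source → lamSq D.lam (D.φ i x.1) ≠ 0}

omit [Fintype ι] [IsManifold (𝓡∂ (n + 1)) ∞ W] [T2Space W] in
/-- The belt disc of the `i`-th chart, `φᵢ⁻¹({‖x‖ ≤ ρ₀, x_λ = 0})`, is compact. [folklore] -/
theorem isCompact_beltSet (i : ι) :
    IsCompact ((D.φ i).symm '' (closedBall (0 : EuclideanSpace ℝ (Fin (n + 1))) D.ρ₀ ∩
      {x | lamSq D.lam x = 0})) :=
  ((isCompact_closedBall _ _).inter_right (isClosed_eq (continuous_lamSq D.lam) continuous_const)).image_of_continuousOn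
    ((D.φ i).continuousOn_symm.mono (inter_subset_left.trans (D.closedBall_ρ₀_subset i)))

omit [IsManifold (𝓡∂ (n + 1)) ∞ W] [T2Space W] in
/-- The range set is the complement of the belt discs. [cite: Kosinski1993, VI §6] -/
theorem gluedRange_eq : D.gluedRange = {x | ∀ i, x.1 ∉ (D.φ i).symm ''
    (closedBall (0 : EuclideanSpace ℝ (Fin (n + 1))) D.ρ₀ ∩ {x | lamSq D.lam x = 0})} := by
  ext x
  constructor
  · rintro hx i ⟨y, ⟨hy, hy0⟩, hyx⟩
    have hyt : y ∈ (D.φ i).target := D.closedBall_ρ₀_subset i hy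
    have hs : x.1 ∈ (D.φ i).source := by rw [← hyx]; exact (D.φ i).map_target hyt
    have hφ : D.φ i x.1 = y := by rw [← hyx]; exact (D.φ i).right_inv hyt
    exact hx i hs (by rw [hφ]; exact hy0)
  · intro hx i hs hL
    refine hx i ⟨D.φ i x.1, ⟨?_, hL⟩, (D.φ i).left_inv hs⟩
    rw [mem_closedBall_zero_iff]
    exact D.norm_le_of_mem_K (D.mem_K_of_F_le hs (by rw [hL]; exact mul_pos outer_pos D.ε_pos) x.2)

omit [IsManifold (𝓡∂ (n + 1)) ∞ W] in
/-- **The range set is open.** [folklore] -/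
theorem isOpen_gluedRange : IsOpen D.gluedRange := by
  rw [D.gluedRange_eq]
  have h : {x : ↥D.slabSet | ∀ i, x.1 ∉ (D.φ i).symm ''
      (closedBall (0 : EuclideanSpace ℝ (Fin (n + 1))) D.ρ₀ ∩ {x | lamSq D.lam x = 0})} =
      Subtype.val ⁻¹' (⋃ i, (D.φ i).symm ''
        (closedBall (0 : EuclideanSpace ℝ (Fin (n + 1))) D.ρ₀ ∩ {x | lamSq D.lam x = 0}))ᶜ := by
    ext x; simp
  rw [h]
  exact (isClosed_iUnion_of_finite fun i => (D.isCompact_beltSet i).isClosed).isOpen_compl.preimage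
    continuous_subtype_val

omit [IsManifold (𝓡∂ (n + 1)) ∞ W] [T2Space W] in
/-- Membership in the range set, unfolded. [folklore] -/
theorem mem_gluedRange_iff (x : ↥D.slabSet) :
    x ∈ D.gluedRange ↔ ∀ i, x.1 ∈ (D.φ i).source → lamSq D.lam (D.φ i x.1) ≠ 0 := Iff.rfl

/-- `σ` lands in the range set. [folklore] -/
theorem glued_mem_gluedRange (a : ↥(HandleAttachingMap.coresComplement (D.attachingMap hn))) :
    D.glued hn a ∈ D.gluedRange := fun i hs =>
  D.lamSq_φ_baseAmb_ne_zero (D.offCore hn a).1 (D.offCore hn a).2 i hs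

/-- `σ⁻¹ x`, for `x` in the range set, is a point of `M ∖ ⋃ᵢ h̄ᵢ(S)`. [folklore] -/
theorem baseInvAmb_mem {x : ↥D.slabSet} (hx : x ∈ D.gluedRange) :
    ∃ h : D.f (D.baseInvAmb x.1) ≤ D.c - D.ε,
      (⟨D.baseInvAmb x.1, h⟩ : ↥D.bodySet) ∈ HandleAttachingMap.coresComplement (D.attachingMap hn) := by
  obtain ⟨hf, hc⟩ := D.f_baseInvAmb_le x.2 hx
  refine ⟨hf, (HandleAttachingMap.mem_coresComplement _).2 fun i hi => ?_⟩
  obtain ⟨hs, hL⟩ := (D.mem_core_attachingMap_iff hn i _).1 hi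
  exact hc i hs hL

open Classical in
/-- **The inverse `σ⁻¹` of `σ`** on its range (junk value `a₀` elsewhere). [cite: Kosinski1993, VII (2.2.7)] -/
def unglue (a₀ : ↥(HandleAttachingMap.coresComplement (D.attachingMap hn))) (x : ↥D.slabSet) :
    ↥(HandleAttachingMap.coresComplement (D.attachingMap hn)) :=
  if h : x ∈ D.gluedRange then ⟨⟨D.baseInvAmb x.1, (D.baseInvAmb_mem hn h).1⟩, (D.baseInvAmb_mem hn h).2⟩
  else a₀

/-- The point of `W` under `σ⁻¹`, on the range set. [folklore] -/
theorem coe_unglue_of_mem (a₀ : ↥(HandleAttachingMap.coresComplement (D.attachingMap hn)))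
    {x : ↥D.slabSet} (hx : x ∈ D.gluedRange) : (D.unglue hn a₀ x).1.1 = D.baseInvAmb x.1 := by
  rw [unglue, dif_pos hx]

/-- `σ⁻¹ (σ a) = a`. [folklore] -/
theorem unglue_glued (a₀ a : ↥(HandleAttachingMap.coresComplement (D.attachingMap hn))) :
    D.unglue hn a₀ (D.glued hn a) = a := by
  apply Subtype.ext; apply Subtype.ext
  rw [D.coe_unglue_of_mem hn a₀ (D.glued_mem_gluedRange hn a), coe_glued,
    D.baseInvAmb_baseAmb (D.offCore hn a).1 (D.offCore hn a).2]

/-- `σ (σ⁻¹ x) = x` on the range set. [folklore] -/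
theorem glued_unglue (a₀ : ↥(HandleAttachingMap.coresComplement (D.attachingMap hn)))
    {x : ↥D.slabSet} (hx : x ∈ D.gluedRange) : D.glued hn (D.unglue hn a₀ x) = x := by
  apply Subtype.ext
  rw [coe_glued, D.coe_unglue_of_mem hn a₀ hx, D.baseAmb_baseInvAmb x.2 hx]

/-- **The range of `σ` is the slab off the belt discs.** [cite: Kosinski1993, VI §6] -/
theorem range_glued (a₀ : ↥(HandleAttachingMap.coresComplement (D.attachingMap hn))) :
    range (D.glued hn) = D.gluedRange :=
  Subset.antisymm (range_subset_iff.2 (D.glued_mem_gluedRange hn))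
    fun _ hx => ⟨_, D.glued_unglue hn a₀ hx⟩

/-- **`σ` is injective.** [folklore] -/
theorem injective_glued : Injective (D.glued hn) := fun a a' h => by
  have := congrArg (D.unglue hn a) h
  rwa [D.unglue_glued, D.unglue_glued] at this

/-- **`σ⁻¹` is smooth on the range.** [folklore] -/
theorem contMDiffOn_unglue (a₀ : ↥(HandleAttachingMap.coresComplement (D.attachingMap hn))) :
    ContMDiffOn (𝓡∂ (n + 1)) (𝓡∂ (n + 1)) ∞ (D.unglue hn a₀) D.gluedRange := by
  intro x₀ hx₀
  apply ContMDiffAt.contMDiffWithinAt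
  rw [← ContMDiffAt.subtypeVal_comp_iff]
  apply D.contMDiffAt_bodySet_mk
  have hev : (fun x => (D.unglue hn a₀ x).1.1) =ᶠ[𝓝 x₀] fun x => D.baseInvAmb x.1 :=
    eventuallyEq_of_mem (D.isOpen_gluedRange.mem_nhds hx₀) fun x hx => D.coe_unglue_of_mem hn a₀ hx
  refine ContMDiffAt.congr_of_eventuallyEq ?_ hev
  exact (D.contMDiffAt_baseInvAmb x₀.2 hx₀).comp x₀ (D.contMDiff_slabSet_val hn x₀)

/-- `σ` maps open sets to open sets. [folklore] -/
theorem isOpenMap_glued : IsOpenMap (D.glued hn) := by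
  intro U hU
  rcases U.eq_empty_or_nonempty with rfl | ⟨a₀, -⟩
  · rw [image_empty]; exact isOpen_empty
  have hU' : D.glued hn '' U = D.gluedRange ∩ D.unglue hn a₀ ⁻¹' U := by
    ext x
    constructor
    · rintro ⟨a, ha, rfl⟩
      exact ⟨D.glued_mem_gluedRange hn a, by rw [mem_preimage, D.unglue_glued]; exact ha⟩
    · rintro ⟨hx, hxU⟩
      exact ⟨_, hxU, D.glued_unglue hn a₀ hx⟩
  rw [hU']
  exact (D.contMDiffOn_unglue hn a₀).continuousOn.isOpen_inter_preimage D.isOpen_gluedRange hU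

/-- **`σ` has open range.** [cite: Kosinski1993, VII (2.2.7)] -/
theorem isOpen_range_glued : IsOpen (range (D.glued hn)) := by
  rw [← image_univ]; exact D.isOpenMap_glued hn _ isOpen_univ

/-- `σ` is an open topological embedding. [folklore] -/
theorem isOpenEmbedding_glued : Topology.IsOpenEmbedding (D.glued hn) :=
  .of_continuous_injective_isOpenMap (D.contMDiff_glued hn).continuous (D.injective_glued hn)
    (D.isOpenMap_glued hn)

/-- **`σ : M ∖ ⋃ᵢ h̄ᵢ(S) → P` is a smooth embedding.** [cite: Kosinski1993, VII (2.2.7)] -/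
theorem isSmoothEmbedding_glued :
    Manifold.IsSmoothEmbedding (𝓡∂ (n + 1)) (𝓡∂ (n + 1)) ∞ (D.glued hn) := by
  refine isSmoothEmbedding_of_contMDiffOn_symm' (D.isOpenEmbedding_glued hn) (D.contMDiff_glued hn) ?_
  intro hne
  obtain ⟨a₀⟩ := id hne
  rw [D.range_glued hn a₀]
  refine (D.contMDiffOn_unglue hn a₀).congr fun x hx => ?_
  obtain ⟨a, rfl⟩ : x ∈ range (D.glued hn) := by rw [D.range_glued hn a₀]; exact hx
  rw [D.unglue_glued]
  exact (D.isOpenEmbedding_glued hn).toOpenPartialHomeomorph_left_inv (f := D.glued hn)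

/-- **`σ` is the identity off the balls**: for a point of `M ∖ ⋃ᵢ h̄ᵢ(S)` outside `⋃ K i`,
`σ a = a` in `W`. [cite: Kosinski1993, VII (2.2.7)] -/
theorem coe_glued_of_not_mem {a : ↥(HandleAttachingMap.coresComplement (D.attachingMap hn))}
    (ha : a.1.1 ∉ ⋃ i, D.K i) : (D.glued hn a).1 = a.1.1 :=
  D.baseAmb_of_not_mem ha

/-- `σ` is the identity over `|x_λ|² ≥ B ε`. [cite: Kosinski1993, VII (2.2.7)] -/
theorem coe_glued_of_outer_le {a : ↥(HandleAttachingMap.coresComplement (D.attachingMap hn))} {i : ι}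
    (hs : a.1.1 ∈ (D.φ i).source) (hL : outer * D.ε ≤ lamSq D.lam (D.φ i a.1.1)) :
    (D.glued hn a).1 = a.1.1 :=
  D.baseAmb_eq_self_of_le hs (D.threshold_le_outer.trans hL)

end SlabData

end Literature.Topology.FourManifolds
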